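import Summits.RiemannHypothesis.RiemannHypothesis.Theorems.GroundBartaEvenWinsBeyondArchDeflationCertBridgeW
import HarnessLib

/-!
# RiemannHypothesis / GroundBarta — rung 4 machinery (`EvenWinsBeyondArch`, stmt-RiemannHypothesis-18807 / 18085),
# EVEN sector: the weighted deflated Temple L-side (edge-only three-prime sliver) — the positivity-grade block

Helper file (`--supports stmt-RiemannHypothesis-18085`), RH-free, no definitions, no named facts.  Prover B (gen 5 of
unit `sr-gb-rung-b`).

Even-sector twins of prover A's `dt_weilOddGroundEnergy_ge_of_ritz_w` (file …WeightedRitz) and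
`dt_weilOddGroundEnergy_ge_of_deflCert_w` (file …CertBridgeW).  The parity-generic cores (`dt_sector_bound_of_ritz_w`,
`dt_weilTwoPrimeQuadratic_sub_edge_le_weilQuadratic_re`, `dt_integral_piecewise_mul`) are reused verbatim; only the
sector (`σ = 1`, even penalty data `q_r % 2 = 0`, `maskPoly_neg_of_even`, `le_weilEvenGroundEnergy_of_forall`) changes.

Use (prover B g5): with `λ = 0` these give `0 ≤ ε_ev(c)` on a window `log 2 ≤ c ≤ 18/25` from an EVEN-block two-prime
rank-one certificate (`WeilCert23.checkR0OK`, `…_rankOne_bound_even_of_cellsOK`) plus the A-layer / R-layer data of six even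
Ritz vectors, hence — with the landed odd block `m72_oddLower_lit` and `dt_weilPositivityOn` — `WeilPositivityOn (log 2)`.

* `dt_weilEvenGroundEnergy_ge_of_ritz_w` — weighted deflated Temple lower bound for `ε_ev(c)` from even `C²` × indicator
  Ritz data (pointwise complement level `n`, weight `w = 1/n`);
* **`dt_weilEvenGroundEnergy_ge_of_deflCert_w`** — from an even-sector two-prime certificate at level `β₂₃` on `[-a₀, a₀]`,
  the edge-only sliver (`y₁ ≤ log 4 − c`, `κ₂ ≥ (log 2)/2`), and the weighted PSD datum `A − λG − R_w ⪰ 0`:  `λ ≤ ε_ev(c)`.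
-/

set_option linter.dupNamespace false

noncomputable section

open MeasureTheory Set Filter
open scoped Topology ComplexConjugate BigOperators

namespace Summit.RiemannHypothesis.RiemannHypothesis.Theorems.EvenWinsBeyondArch

open Literature.NumberTheory.LFunctions
open Summit.RiemannHypothesis.RiemannHypothesis.Theorems.OddSector (weilDirichletEnergy₂ weilPoleForm₂)

/-- **Weighted deflated Temple lower bound for `ε_ev(c)` from even `C²` × indicator Ritz data**:
`λ ≤ weilEvenGroundEnergy c` (even twin of `dt_weilOddGroundEnergy_ge_of_ritz_w`).
[cite: WeinsteinStenger1972, Ch. 5 §9 eq. (2) (k = 1: Temple's formula)] -/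
theorem dt_weilEvenGroundEnergy_ge_of_ritz_w {c : ℝ} (hc : 0 < c) {k : ℕ}
    (g : Fin k → ℝ → ℝ) (hg : ∀ i, ContDiff ℝ 2 (g i)) (hge : ∀ i x, g i (-x) = g i x)
    (v F : Fin k → ℝ → ℂ) (hv : ∀ i x, v i x = (((Icc (-c) c).indicator (g i) x : ℝ) : ℂ))
    (hF : ∀ i y, F i y = (Icc (-c) c).indicator (fun y ↦
        2 * (∫ x, v i x * (Real.cosh (x / 2) : ℂ)) * (Real.cosh (y / 2) : ℂ) -
          2 * (∫ x, v i x * (Real.sinh (x / 2) : ℂ)) * (Real.sinh (y / 2) : ℂ) +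
        (∑ n ∈ weilPrimeIndex c, (((ArithmeticFunction.vonMangoldt n : ℝ) / Real.sqrt n : ℝ) : ℂ) *
          (2 * v i y - v i (y - Real.log n) - v i (y + Real.log n))) +
        ∫ t in Ioi 0, (weilArchDensity t : ℂ) * (2 * v i y - v i (y - t) - v i (y + t))) y -
      (weilMarkovConstant c : ℂ) * v i y)
    (W : Fin k → Fin k → ℝ) (μ : Fin k → ℝ) (lam : ℝ) (hμ : ∀ i, 0 ≤ μ i)
    {n w : ℝ → ℝ} (hnm : Measurable n) (hwm : Measurable w) {C : ℝ} (hnC : ∀ y, |n y| ≤ C) (hwC : ∀ y, |w y| ≤ C)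
    (hn0 : ∀ y, 0 ≤ n y) (hw0 : ∀ y, 0 ≤ w y) (hwn : ∀ y, w y * n y = 1)
    (hcert : ∀ φ : ℝ → ℂ, IsWeilTest φ → tsupport φ ⊆ Icc (-c) c → (∀ x, φ (-x) = φ x) →
      (∫ y, n y * ‖φ y‖ ^ 2) + lam * ∫ x, ‖φ x‖ ^ 2 ≤
        (weilQuadratic φ).re + ∑ i, μ i * ‖∫ x, φ x * conj (v i x)‖ ^ 2)
    (hPSD : ∀ α : Fin k → ℝ, 0 ≤ ∑ i, ∑ j, α i * α j *
      ((weilPoleForm₂ (v i) (v j) + weilDirichletEnergy₂ c (v i) (v j) -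
          weilMarkovConstant c * ∫ x, (v i x * conj (v j x)).re) - lam * (∫ x, (v i x * conj (v j x)).re) -
        ∫ y, w y * ((F i - ∑ l, W i l • v l) y * conj ((F j - ∑ l, W j l • v l) y)).re)) :
    lam ≤ weilEvenGroundEnergy c := by
  refine le_weilEvenGroundEnergy_of_forall hc fun φ hφ hφs hφe hφn ↦ ?_
  have h := dt_sector_bound_of_ritz_w hc 1 g hg (fun i x ↦ by rw [hge i x]; ring) v F hv hF W μ lam hμ
    hnm hwm hnC hwC hn0 hw0 hwn (fun φ hφ hφs hφp ↦ hcert φ hφ hφs (fun x ↦ by simpa using hφp x)) hPSD hφ hφs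
    (fun x ↦ by simpa using hφe x)
  rwa [hφn, mul_one] at h

/-- **The deflated Temple EVEN-sector bound from a rank-one augmented two-prime certificate, edge-only sliver.**
Hypotheses as `dt_weilOddGroundEnergy_ge_of_deflCert_w` with the parities flipped: window `0 < c ≤ a₀`, `c ≤ (log 5)/2`,
certificate conclusion `hcert23` at level `β₂₃` on the EVEN tests of `[-a₀, a₀]` (penalty data `R` of even parity,
non-negative weights), trial vectors `v_i = 𝟙_{[-c,c]} · maskPoly (R_i) n a₀` with explicit window images, any `W`, a
majorant `κ₂ ≥ (log 2)/2`, `λ < β₂₃ − κ₂`, a threshold `y₁ ≤ log 4 − c`, and the WEIGHTED PSD datum `A − λG − R_w ⪰ 0`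
with `w = 1/(β₂₃ − κ₂ − λ)` on `|y| ≥ y₁`, `w = 1/(β₂₃ − λ)` on `|y| < y₁`.  Conclusion: `λ ≤ ε_ev(c)`.  With `λ = 0` this
is the positivity-grade even block of the window. [folklore] -/
theorem dt_weilEvenGroundEnergy_ge_of_deflCert_w {c : ℝ} (hc : 0 < c) (hc5 : c ≤ Real.log 5 / 2)
    {a₀ : ℝ} (hca : c ≤ a₀) (R : List (ℚ × ℕ × List ℚ)) (n : ℕ) {β₂₃ : ℝ}
    (hReven : ∀ i : Fin R.length, (R.get i).2.1 % 2 = 0) (hRμ : ∀ i : Fin R.length, 0 ≤ (R.get i).1)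
    (hcert23 : ∀ g : ℝ → ℂ, IsWeilTest g → tsupport g ⊆ Icc (-a₀) a₀ → (∀ x, g (-x) = g x) →
      β₂₃ * weilNorm2Sq g ≤ weilTwoPrimeQuadratic g +
        (R.map fun r ↦ (r.1 : ℝ) * ‖∑ k ∈ Finset.range n, ((maskV r k : ℚ) : ℂ) * weilMoment a₀ g k‖ ^ 2).sum)
    (v F : Fin R.length → ℝ → ℂ)
    (hv : ∀ i x, v i x = (((Icc (-c) c).indicator (fun x ↦ maskPoly (R.get i) n a₀ x) x : ℝ) : ℂ))
    (hF : ∀ i y, F i y = (Icc (-c) c).indicator (fun y ↦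
        2 * (∫ x, v i x * (Real.cosh (x / 2) : ℂ)) * (Real.cosh (y / 2) : ℂ) -
          2 * (∫ x, v i x * (Real.sinh (x / 2) : ℂ)) * (Real.sinh (y / 2) : ℂ) +
        (∑ m ∈ weilPrimeIndex c, (((ArithmeticFunction.vonMangoldt m : ℝ) / Real.sqrt m : ℝ) : ℂ) *
          (2 * v i y - v i (y - Real.log m) - v i (y + Real.log m))) +
        ∫ t in Ioi 0, (weilArchDensity t : ℂ) * (2 * v i y - v i (y - t) - v i (y + t))) y -
      (weilMarkovConstant c : ℂ) * v i y)
    (W : Fin R.length → Fin R.length → ℝ) {κ₂ : ℝ} (hκ : Real.log 2 / 2 ≤ κ₂) {lam : ℝ} (hlam : lam < β₂₃ - κ₂)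
    {y₁ : ℝ} (hy : y₁ ≤ Real.log 4 - c)
    (hPSD : ∀ α : Fin R.length → ℝ, 0 ≤ ∑ i, ∑ j, α i * α j *
      ((weilPoleForm₂ (v i) (v j) + weilDirichletEnergy₂ c (v i) (v j) -
          weilMarkovConstant c * ∫ x, (v i x * conj (v j x)).re) - lam * (∫ x, (v i x * conj (v j x)).re) -
        ∫ y, {u : ℝ | y₁ ≤ |u|}.piecewise (fun _ ↦ 1 / (β₂₃ - κ₂ - lam)) (fun _ ↦ 1 / (β₂₃ - lam)) y *
          ((F i - ∑ l, W i l • v l) y * conj ((F j - ∑ l, W j l • v l) y)).re)) :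
    lam ≤ weilEvenGroundEnergy c := by
  have hE : MeasurableSet {u : ℝ | y₁ ≤ |u|} := measurableSet_le measurable_const continuous_abs.measurable
  set nE : ℝ := β₂₃ - κ₂ - lam with hnE
  set nI : ℝ := β₂₃ - lam with hnI
  have hnE0 : 0 < nE := by rw [hnE]; linarith
  have hlog : 0 ≤ Real.log 2 / 2 := by positivity
  have hκ0 : 0 ≤ κ₂ := hlog.trans hκ
  have hnI0 : 0 < nI := by rw [hnI]; linarith
  have hnEI : nE ≤ nI := by rw [hnE, hnI]; linarith
  set C : ℝ := nI + 1 / nE with hC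
  -- the weights
  have hpw : ∀ (a b : ℝ) (y : ℝ), {u : ℝ | y₁ ≤ |u|}.piecewise (fun _ ↦ a) (fun _ ↦ b) y = a ∨
      {u : ℝ | y₁ ≤ |u|}.piecewise (fun _ ↦ a) (fun _ ↦ b) y = b := by
    intro a b y
    by_cases hy' : y ∈ {u : ℝ | y₁ ≤ |u|}
    · exact Or.inl (Set.piecewise_eq_of_mem _ _ _ hy')
    · exact Or.inr (Set.piecewise_eq_of_notMem _ _ _ hy')
  have hmeas : ∀ a b : ℝ, Measurable ({u : ℝ | y₁ ≤ |u|}.piecewise (fun _ ↦ a) (fun _ ↦ b)) := fun a b ↦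
    Measurable.piecewise hE measurable_const measurable_const
  refine dt_weilEvenGroundEnergy_ge_of_ritz_w hc (fun i x ↦ maskPoly (R.get i) n a₀ x)
    (fun i ↦ contDiff_maskPoly (R.get i) n a₀) (fun i x ↦ maskPoly_neg_of_even (R.get i) (hReven i) n a₀ x)
    v F hv hF W (fun i ↦ ((R.get i).1 : ℝ)) lam (fun i ↦ by exact_mod_cast hRμ i)
    (n := {u : ℝ | y₁ ≤ |u|}.piecewise (fun _ ↦ nE) (fun _ ↦ nI)) (w := {u : ℝ | y₁ ≤ |u|}.piecewise (fun _ ↦ 1 / nE) (fun _ ↦ 1 / nI))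
    (C := C)
    (hmeas _ _) (hmeas _ _) ?_ ?_ ?_ ?_ ?_ ?_ hPSD
  · -- |n| ≤ C
    intro y
    have h1 : 0 ≤ 1 / nE := by positivity
    rcases hpw nE nI y with h | h <;> rw [h]
    · rw [abs_of_pos hnE0, hC]; linarith
    · rw [abs_of_pos hnI0, hC]; linarith
  · -- |w| ≤ C
    intro y
    have h1 : 1 / nI ≤ 1 / nE := one_div_le_one_div_of_le hnE0 hnEI
    rcases hpw (1 / nE) (1 / nI) y with h | h <;> rw [h]
    · rw [abs_of_pos (by positivity), hC]; linarith [hnI0.le]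
    · rw [abs_of_pos (by positivity), hC]; linarith [hnI0.le]
  · intro y; rcases hpw nE nI y with h | h <;> rw [h] <;> positivity
  · intro y; rcases hpw (1 / nE) (1 / nI) y with h | h <;> rw [h] <;> positivity
  · -- w n = 1
    intro y
    by_cases hy' : y ∈ {u : ℝ | y₁ ≤ |u|}
    · rw [Set.piecewise_eq_of_mem _ _ _ hy', Set.piecewise_eq_of_mem _ _ _ hy']; field_simp
    · rw [Set.piecewise_eq_of_notMem _ _ _ hy', Set.piecewise_eq_of_notMem _ _ _ hy']; field_simp
  · -- the weighted certificate on smooth even tests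
    intro φ hφ hφs hφe
    have hφa : tsupport φ ⊆ Icc (-a₀) a₀ := hφs.trans (Icc_subset_Icc (by linarith) hca)
    have h23 := hcert23 φ hφ hφa hφe
    have hsl := dt_weilTwoPrimeQuadratic_sub_edge_le_weilQuadratic_re hφ hφs hc5 hy
    have hsum : (R.map fun r ↦ (r.1 : ℝ) * ‖∑ k ∈ Finset.range n, ((maskV r k : ℚ) : ℂ) * weilMoment a₀ φ k‖ ^ 2).sum =
        ∑ i : Fin R.length, ((R.get i).1 : ℝ) * ‖∫ x, φ x * conj (v i x)‖ ^ 2 := by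
      rw [dt_list_sum_map_eq_sum_get]
      refine Finset.sum_congr rfl fun i _ ↦ ?_
      rw [dt_rankOne_term_eq (R.get i) n a₀ hφ hφs]
      simp only [hv i]
    have hnorm : weilNorm2Sq φ = ∫ x, ‖φ x‖ ^ 2 := rfl
    have h2 : Integrable fun u : ℝ ↦ ‖φ u‖ ^ 2 := hφ.integrable_norm_sq
    -- `∫ n|φ|² = (β₂₃ − λ)∫|φ|² − κ₂ ∫ 𝟙_E |φ|²`
    have hn_int : (∫ y, {u : ℝ | y₁ ≤ |u|}.piecewise (fun _ ↦ nE) (fun _ ↦ nI) y * ‖φ y‖ ^ 2) =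
        nI * (∫ y, ‖φ y‖ ^ 2) + (nE - nI) * ∫ y, {u : ℝ | y₁ ≤ |u|}.indicator (fun u ↦ ‖φ u‖ ^ 2) y :=
      dt_integral_piecewise_mul hE nE nI h2
    have hEI : nE - nI = -κ₂ := by rw [hnE, hnI]; ring
    rw [hsum, hnorm] at h23
    rw [hn_int, hEI, hnI]
    have hX0 : 0 ≤ ∫ y, {u : ℝ | y₁ ≤ |u|}.indicator (fun u ↦ ‖φ u‖ ^ 2) y :=
      integral_nonneg fun y ↦ Set.indicator_nonneg (fun _ _ ↦ by positivity) y
    have hκX := mul_le_mul_of_nonneg_right hκ hX0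
    have : (β₂₃ - lam) * (∫ y, ‖φ y‖ ^ 2) + -κ₂ * (∫ y, {u : ℝ | y₁ ≤ |u|}.indicator (fun u ↦ ‖φ u‖ ^ 2) y) +
        lam * ∫ x, ‖φ x‖ ^ 2 = β₂₃ * (∫ y, ‖φ y‖ ^ 2) - κ₂ * ∫ y, {u : ℝ | y₁ ≤ |u|}.indicator (fun u ↦ ‖φ u‖ ^ 2) y := by
      ring
    rw [this]
    linarith

end Summit.RiemannHypothesis.RiemannHypothesis.Theorems.EvenWinsBeyondArch

end
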